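import Mathlib
import HarnessLib
import Summits.Ventures.LatticeQCDFlow.Exactness.SUNLeapfrogHMCWalk
import Summits.Ventures.LatticeQCDFlow.Exactness.SUNProductTrajectory

/-!
# Multi-step leapfrog HMC on `SU(N)` lattice gauge fields: the kernel at every `nstep`, its exactness, and the trajectory read in the matrix algebra

HONEST FRAMING: exact (Metropolis-corrected) sampling algorithms for lattice gauge theory;
figures of merit are autocorrelation/cost numbers at stated couplings and volumes; no
continuum-physics claim.

Venture `LatticeQCDFlow` (cell pub-lqcd), topic `Exactness`, FANOUT row 9 (eng-latcore, the
engine `latflow.core.hmc.HMC(f, β, 'leapfrog').trajectory(τ, nstep)` / `sun_2d.HMC2D` on `SU(N)`: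
momenta `P_l ∈ 𝔰𝔲(N)`, `nstep` P-first leapfrog steps `P ← P − ½ε∂S`, `U_l ← expm(εP_l) U_l`,
`P ← P − ½ε∂S`, Metropolis test on `H = T(P) + S(U)`).  NEW WORK of the cell over the tree
(`SUNLeapfrogHMC.lean`: the single-step kernel, `sunExpDrift`, `sunMomentumLaw`; `SplittingWords` /
`LeapfrogHMCDoeblin`: palindromic words, `flip`, `kick`, `drift`, `mulDrift`; `MomentumRefresh.hmc_config_exact`;
`KickedProductTrajectory.lean`: `plfStep`, `plfTraj`, `PLFBounds`; `SUNProductTrajectory.lean`: `coeConfig`,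
`linkExp`, `linkLog`, `sunJ`, `sunCoordOf`, `algForce`); nothing here is cited as a fact.  Printed
counterparts, NAMED ONLY: Duane–Kennedy–Pendleton–Roweth 1987; Gottlieb–Liu–Toussaint–Renken–Sugar 1987.

* §1 `sunLeapfrogProposalN ι hι ε g n = flip * (K(g) D(e_ε) K(g))ⁿ` (`_one`: the tree's single-step
  proposal, `rfl`; measurable, an involution, Liouville for `Haar^{⊗links} ⊗ μ^{⊗links}`);
  **`sunLeapfrogHMCN`** — THE CONFIGURATION KERNEL AT `nstep = n` (`_one`: the tree's `sunLeapfrogHMC`,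
  `rfl`); **`sunLeapfrogHMCN_invariant`** — EXACT AT EVERY `nstep`: `e^{−S}·Haar^{⊗links}` is invariant
  for every measurable `S`, `T` with `Z_T < ∞`, every `ε`, every measurable increment `g`;
  `sunLeapfrogHMCN_invariant_gibbs`.
* §2 `sunEmbed u (U, p) = (↑(U u⁻¹), p)` reads the phase space in `(links → M_N(ℂ)) × (links → E)`;
  **`semiconj_sunEmbed`** — THE CURVED WORD IS THE ALGEBRA STEP: `sunEmbed u ∘ (K D K) = plfStep linkExp
  (sunJ ι) (algForce u g) ε ∘ sunEmbed u`; hence `coeConfig_fst_sunLeapfrogProposalN`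
  (`↑((Ψ_n(U,p)).1 · U⁻¹) = W_n(p)`) and `snd_sunLeapfrogProposalN` (`= −(m_n − G W_n)`).
* §3 `sunLeapfrogN_energy_window` — on the momentum ball `‖p‖ ≤ R`: `H(Ψ_n(U,p)) ≤ H(U,p) + 2s +
  τ_T(R + 2(n+1)b)` (`T ≥ 0` bounded by `τ_T` on boxes, increment bounded by `b`, action by `s`).
* §4 `sunPosMap` — the proposed configuration read through the logarithm, `coordOf (log W_n(p)_l)`;
  **`fst_sunLeapfrogProposalN_eq`** — when `‖W_n(p) − 1‖` is within the chart radius,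
  `(Ψ_n(U,p)).1 = (suExp (sunPosMap p)_l · U_l)_l`.

NOT CLAIMED here: ergodicity (next file, `SUNMultiStepLeapfrogHMCErgodic.lean`, short trajectories
only); OMF words / `tau_jitter`; floating point.
-/

noncomputable section

namespace Summit.Ventures.LatticeQCDFlow.Exactness

open MeasureTheory ProbabilityTheory ProbabilityTheory.Kernel Set Metric Function NormedSpace
open Literature.MathematicalPhysics.QuantumFieldTheory (haarProbability)
open scoped ENNReal Matrix Matrix.Norms.Operator NNReal

set_option backward.isDefEq.respectTransparency false

variable {n : Type*} [Fintype n] [DecidableEq n]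
variable {E : Type*} [NormedAddCommGroup E] [NormedSpace ℝ E]
variable (ι : E →ₗ[ℝ] Matrix n n ℂ) (hι : ∀ a, (ι a)ᴴ = -ι a ∧ (ι a).trace = 0)
variable {L : Type*}

/-! ## §1 The `n`-step proposal and kernel; exactness at every `nstep` -/

section Defs

variable (ε : ℝ) (g : (L → Matrix.specialUnitaryGroup n ℂ) → L → E) (N : ℕ)

/-- **The `n`-step proposal map**: `n` P-first leapfrog steps `(K(g) D(e_ε) K(g))ⁿ` on
`SU(N)^links × (links → E)` followed by the momentum flip. -/
def sunLeapfrogProposalN : Equiv.Perm ((L → Matrix.specialUnitaryGroup n ℂ) × (L → E)) :=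
  flip * palindromicWord [kick g] (drift (mulDrift (sunExpDrift ι hι ε))) ^ N

/-- At `n = 1` this is the tree's single-step proposal. -/
theorem sunLeapfrogProposalN_one : sunLeapfrogProposalN ι hι ε g 1 = sunLeapfrogProposal ι hι ε g := rfl

/-- The `n`-step proposal map is an involution (time reversal of the palindromic word). -/
theorem involutive_sunLeapfrogProposalN : Function.Involutive (⇑(sunLeapfrogProposalN ι hι ε g N)) :=
  (palindromicWord_pow_isFlipReversible flip_mul_flip
    (drift_isFlipReversible (mulDrift_reversal (sunExpDrift_neg ι hι ε)))
    (fun A hA => by rw [List.mem_singleton] at hA; subst hA; exact kick_isFlipReversible g) N).involutive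

variable [MeasurableSpace E] [BorelSpace E] {g}

/-- One leapfrog step is measurable (for measurable `g`). -/
theorem measurable_sunLeapfrogWord [FiniteDimensional ℝ E] [Countable L] (hg : Measurable g) :
    Measurable (⇑(palindromicWord [kick g] (drift (mulDrift (sunExpDrift (L := L) ι hι ε))))) := by
  rw [palindromicWord_kick_drift, Equiv.Perm.coe_mul, Equiv.Perm.coe_mul]
  exact (measurable_kick hg).comp
    ((measurable_drift (measurable_mulDrift (measurable_sunExpDrift ι hι ε))).comp (measurable_kick hg))

/-- The `n`-step proposal map is measurable (for measurable `g`). -/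
theorem measurable_sunLeapfrogProposalN [FiniteDimensional ℝ E] [Countable L] (hg : Measurable g) :
    Measurable (⇑(sunLeapfrogProposalN ι hι ε g N)) := by
  rw [sunLeapfrogProposalN, Equiv.Perm.coe_mul, Equiv.Perm.coe_pow]
  exact measurable_flip.comp ((measurable_sunLeapfrogWord ι hι ε hg).iterate N)

variable [Fintype L] (μ : Measure E) (T : (L → E) → ℝ)

/-- The `n`-step proposal map preserves `Haar^{⊗links} ⊗ μ^{⊗links}` (Liouville). -/
theorem measurePreserving_sunLeapfrogProposalN [FiniteDimensional ℝ E] [μ.IsAddHaarMeasure] (hg : Measurable g) :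
    MeasurePreserving (⇑(sunLeapfrogProposalN ι hι ε g N))
      ((Measure.pi fun _ : L => haarProbability (Matrix.specialUnitaryGroup n ℂ)).prod (Measure.pi fun _ : L => μ))
      ((Measure.pi fun _ : L => haarProbability (Matrix.specialUnitaryGroup n ℂ)).prod (Measure.pi fun _ : L => μ)) := by
  haveI := isNegInvariant_pi (L := L) μ
  rw [sunLeapfrogProposalN, Equiv.Perm.coe_mul]
  exact measurePreserving_flip.comp (measurePreserving_perm_pow
    (measurePreserving_palindromicWord
      (measurePreserving_drift (measurable_mulDrift (measurable_sunExpDrift ι hι ε))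
        (measurePreserving_mulDrift (sunExpDrift ι hι ε)))
      (fun A hA => by rw [List.mem_singleton] at hA; subst hA; exact measurePreserving_kick hg)) N)

/-- **THE CONFIGURATION KERNEL AT `nstep = n`** (`hmc.HMC(f, β, 'leapfrog').trajectory(τ = nε, nstep = n)`
on `SU(N)`): refresh `p ∼ Z_T⁻¹e^{−T}`, `n` P-first leapfrog steps, flip, Metropolis test on `S + T`,
forget `p`. -/
def sunLeapfrogHMCN [FiniteDimensional ℝ E] (hg : Measurable g)
    (S : (L → Matrix.specialUnitaryGroup n ℂ) → ℝ) (N : ℕ) :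
    Kernel (L → Matrix.specialUnitaryGroup n ℂ) (L → Matrix.specialUnitaryGroup n ℂ) :=
  refreshUpdate
    (involMH (⇑(sunLeapfrogProposalN ι hι ε g N)) (measurable_sunLeapfrogProposalN ι hι ε N hg)
      fun z => S z.1 + T z.2)
    (sunMomentumLaw μ T)

/-- At `n = 1` this is the tree's single-step kernel `sunLeapfrogHMC`. -/
theorem sunLeapfrogHMCN_one [FiniteDimensional ℝ E] (hg : Measurable g) (S : (L → Matrix.specialUnitaryGroup n ℂ) → ℝ) :
    sunLeapfrogHMCN ι hι ε μ T hg S 1 = sunLeapfrogHMC ι hι μ T ε hg S := rfl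

variable {ε μ T N}

/-- **EXACTNESS AT EVERY `nstep`**: the kernel leaves `e^{−S} · Haar^{⊗links}` invariant, for every
measurable `S`, every measurable `T` with `Z_T < ∞`, every `ε`, every measurable `g`, every `n`. -/
theorem sunLeapfrogHMCN_invariant [FiniteDimensional ℝ E] [μ.IsAddHaarMeasure] (hg : Measurable g) (hT : Measurable T)
    (hZ : sunMomentumWeight (L := L) μ T univ ≠ ⊤) {S : (L → Matrix.specialUnitaryGroup n ℂ) → ℝ} (hS : Measurable S)
    (N : ℕ) :
    Invariant (sunLeapfrogHMCN ι hι ε μ T hg S N)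
      ((Measure.pi fun _ : L => haarProbability (Matrix.specialUnitaryGroup n ℂ)).withDensity
        fun u => ENNReal.ofReal (Real.exp (-S u))) :=
  hmc_config_exact (vol := Measure.pi fun _ : L => haarProbability (Matrix.specialUnitaryGroup n ℂ))
    (volP := Measure.pi fun _ : L => μ) (hΦ := measurable_sunLeapfrogProposalN ι hι ε N hg) hS hT
    (involutive_sunLeapfrogProposalN ι hι ε g N) (measurePreserving_sunLeapfrogProposalN ι hι ε N μ hg)
    (sunMomentumWeight_univ_ne_zero μ T hT) hZ

/-- **… hence the normalised Gibbs law `gibbsProbability Haar^{⊗links} e^{−S}` is invariant, at every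
`nstep`.** -/
theorem sunLeapfrogHMCN_invariant_gibbs [FiniteDimensional ℝ E] [μ.IsAddHaarMeasure] (hg : Measurable g)
    (hT : Measurable T) (hZ : sunMomentumWeight (L := L) μ T univ ≠ ⊤)
    {S : (L → Matrix.specialUnitaryGroup n ℂ) → ℝ} (hS : Measurable S) (N : ℕ) :
    Invariant (sunLeapfrogHMCN ι hι ε μ T hg S N)
      (gibbsProbability (Measure.pi fun _ : L => haarProbability (Matrix.specialUnitaryGroup n ℂ))
        fun u => Real.exp (-S u)) :=
  invariant_gibbsProbability (sunLeapfrogHMCN_invariant ι hι hg hT hZ hS N)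

end Defs

/-! ## §2 The curved word is the algebra step, read through `(U, p) ↦ (↑(U u⁻¹), p)` -/

section Embed

variable (u : L → Matrix.specialUnitaryGroup n ℂ) (ε : ℝ) (g : (L → Matrix.specialUnitaryGroup n ℂ) → L → E)

/-- **The phase space read in the algebra** at base `u`: `sunEmbed u (U, p) = (↑(U u⁻¹), p)`. -/
def sunEmbed (z : (L → Matrix.specialUnitaryGroup n ℂ) × (L → E)) : (L → Matrix n n ℂ) × (L → E) :=
  (coeConfig (z.1 * u⁻¹), z.2)

omit [NormedAddCommGroup E] [NormedSpace ℝ E] in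
/-- The base configuration is read as `(1, p)`. -/
theorem sunEmbed_base (p : L → E) : sunEmbed u (u, p) = (1, p) := by
  simp only [sunEmbed, mul_inv_cancel, coeConfig_one]

variable [Fintype L] [FiniteDimensional ℝ E]

omit [Fintype L] in
/-- **The drift factors read in the algebra**: `↑(e_ε(m) · U · u⁻¹) = linkExp (ε • sunJ ι m) · ↑(U u⁻¹)`. -/
theorem coeConfig_mulDrift (m : L → E) (U : L → Matrix.specialUnitaryGroup n ℂ) :
    coeConfig (mulDrift (sunExpDrift ι hι ε) m U * u⁻¹) = linkExp (ε • sunJ ι m) * coeConfig (U * u⁻¹) := by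
  have h1 : mulDrift (sunExpDrift ι hι ε) m U = sunExpDrift ι hι ε m * U := rfl
  have h2 : coeConfig (sunExpDrift (L := L) ι hι ε m) = linkExp (ε • sunJ ι m) := by
    funext l
    simp only [coeConfig_apply, sunExpDrift_apply, coe_suExp, map_smul, linkExp_apply, Pi.smul_apply, sunJ_apply]
  rw [h1, coeConfig_mul, coeConfig_mul, h2, coeConfig_mul, mul_assoc]

/-- **THE INTERTWINING**: `sunEmbed u ∘ (K(g) D(e_ε) K(g)) = plfStep linkExp (sunJ ι) (algForce u g) ε ∘ sunEmbed u`. -/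
theorem semiconj_sunEmbed :
    Semiconj (sunEmbed u) (⇑(palindromicWord [kick g] (drift (mulDrift (sunExpDrift ι hι ε)))))
      (plfStep linkExp (sunJ ι) (algForce u g) ε) := by
  intro z
  have hkick : algForce u g (coeConfig (z.1 * u⁻¹)) = g z.1 := algForce_coeConfig u g z.1
  have hkey := coeConfig_mulDrift ι hι u ε (z.2 + g z.1) z.1
  have hkick2 : algForce u g (linkExp (ε • sunJ ι (z.2 + g z.1)) * coeConfig (z.1 * u⁻¹)) =
      g (mulDrift (sunExpDrift ι hι ε) (z.2 + g z.1) z.1) := by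
    rw [← hkey, algForce_coeConfig]
  rw [palindromicWord_kick_drift, Equiv.Perm.coe_mul, Equiv.Perm.coe_mul]
  simp only [Function.comp_apply, sunEmbed, kick, drift, Equiv.coe_fn_mk, plfStep, hkick, hkick2, hkey]

/-- **Iterating**: `sunEmbed u ((K D K)^[k] (u, p)) = (plfStep …)^[k] (1, p)`. -/
theorem sunEmbed_word_iterate (p : L → E) (k : ℕ) :
    sunEmbed u ((⇑(palindromicWord [kick g] (drift (mulDrift (sunExpDrift ι hι ε)))))^[k] (u, p)) =
      (plfStep linkExp (sunJ ι) (algForce u g) ε)^[k] (1, p) := by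
  have h := (semiconj_sunEmbed ι hι u ε g).iterate_right k (u, p)
  rw [sunEmbed_base] at h
  exact h

/-- **The proposed configuration read in the algebra is `W_n`**:
`↑((Ψ_n (U, p)).1 · U⁻¹) = (plfTraj linkExp (sunJ ι) (algForce U g) ε p n).1`. -/
theorem coeConfig_fst_sunLeapfrogProposalN (N : ℕ) (p : L → E) :
    coeConfig ((sunLeapfrogProposalN ι hι ε g N (u, p)).1 * u⁻¹) =
      (plfTraj linkExp (sunJ ι) (algForce u g) ε p N).1 := by
  have h := congr_arg Prod.fst (sunEmbed_word_iterate ι hι u ε g p N)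
  rw [plfStep_iterate_fst] at h
  rw [sunLeapfrogProposalN, Equiv.Perm.coe_mul, Function.comp_apply, flip_apply, Equiv.Perm.coe_pow]
  exact h

/-- **The proposed momentum is minus the algebra trajectory's final momentum**:
`(Ψ_n (U, p)).2 = −(m_n − algForce U g W_n)`. -/
theorem snd_sunLeapfrogProposalN (N : ℕ) (p : L → E) :
    (sunLeapfrogProposalN ι hι ε g N (u, p)).2 =
      -((plfStep linkExp (sunJ ι) (algForce u g) ε)^[N] (1, p)).2 := by
  have h := congr_arg Prod.snd (sunEmbed_word_iterate ι hι u ε g p N)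
  rw [sunLeapfrogProposalN, Equiv.Perm.coe_mul, Function.comp_apply, flip_apply, Equiv.Perm.coe_pow]
  exact congr_arg Neg.neg h

/-- The proposed configuration itself: `(Ψ_n (U, p)).1 = (W_n(p)_l · U_l)_l` in the algebra. -/
theorem coeConfig_fst_sunLeapfrogProposalN' (N : ℕ) (p : L → E) :
    coeConfig (sunLeapfrogProposalN ι hι ε g N (u, p)).1 =
      (plfTraj linkExp (sunJ ι) (algForce u g) ε p N).1 * coeConfig u := by
  rw [← coeConfig_fst_sunLeapfrogProposalN ι hι u ε g N p, coeConfig_mul, mul_assoc, coeConfig_inv_mul, mul_one]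

end Embed

/-! ## §3 The energy window of `n` steps on the momentum ball -/

section Energy

variable [Fintype L] [FiniteDimensional ℝ E]
variable {u : L → Matrix.specialUnitaryGroup n ℂ} {ε : ℝ} {g : (L → Matrix.specialUnitaryGroup n ℂ) → L → E}
variable {T : (L → E) → ℝ} {τ : ℝ → ℝ} {C b K ρ η : ℝ}

/-- **The final momentum stays in a box**: `‖(Ψ_n(U,p)).2‖ ≤ R + 2(n+1)b` for `‖p‖ ≤ R`, under the
standing hypotheses at base `U`. -/
theorem norm_snd_sunLeapfrogProposalN_le (h : PLFBounds linkExp (sunJ ι) (algForce u g) sunGroupSet C b K ρ η)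
    {R : ℝ} {p : L → E} (hp : ‖p‖ ≤ R) (N : ℕ) :
    ‖(sunLeapfrogProposalN ι hι ε g N (u, p)).2‖ ≤ R + 2 * ((N : ℝ) + 1) * b := by
  rw [snd_sunLeapfrogProposalN, norm_neg]
  exact norm_plfStep_iterate_snd_le h ε p hp N

/-- **THE ENERGY WINDOW OF `n` LEAPFROG STEPS**: on `‖p‖ ≤ R`, with a kinetic term `T ≥ 0` bounded by
`τ_T` on boxes, an increment bounded by `b` (standing hypotheses at base `U`) and an action bounded by
`s`: `H(Ψ_n(U, p)) ≤ H(U, p) + 2s + τ_T(R + 2(n+1)b)`. -/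
theorem sunLeapfrogN_energy_window (h : PLFBounds linkExp (sunJ ι) (algForce u g) sunGroupSet C b K ρ η)
    (hT0 : ∀ p, 0 ≤ T p) (hTle : ∀ (R : ℝ) (p : L → E), (∀ l, ‖p l‖ ≤ R) → T p ≤ τ R)
    {S : (L → Matrix.specialUnitaryGroup n ℂ) → ℝ} {s : ℝ} (hs : ∀ v, |S v| ≤ s) {R : ℝ} {p : L → E}
    (hp : ‖p‖ ≤ R) (N : ℕ) :
    (fun z : (L → Matrix.specialUnitaryGroup n ℂ) × (L → E) => S z.1 + T z.2) (sunLeapfrogProposalN ι hι ε g N (u, p)) ≤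
      (fun z : (L → Matrix.specialUnitaryGroup n ℂ) × (L → E) => S z.1 + T z.2) (u, p) + (2 * s + τ (R + 2 * ((N : ℝ) + 1) * b)) := by
  simp only
  have h1 : S (sunLeapfrogProposalN ι hι ε g N (u, p)).1 ≤ s := (abs_le.1 (hs _)).2
  have h2 : -s ≤ S u := (abs_le.1 (hs u)).1
  have h3 : 0 ≤ T p := hT0 p
  have h4 : T (sunLeapfrogProposalN ι hι ε g N (u, p)).2 ≤ τ (R + 2 * ((N : ℝ) + 1) * b) :=
    hTle _ _ fun l => (norm_le_pi_norm _ l).trans (norm_snd_sunLeapfrogProposalN_le ι hι h hp N)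
  linarith

end Energy

/-! ## §4 The proposed configuration through the logarithm -/

section Chart

variable [Fintype L] [FiniteDimensional ℝ E] (hinj : Injective ι)
variable (u : L → Matrix.specialUnitaryGroup n ℂ) (ε : ℝ) (g : (L → Matrix.specialUnitaryGroup n ℂ) → L → E) (N : ℕ)

/-- **The proposed configuration read through the logarithm**, in coordinates:
`sunPosMap p = (coordOf (log W_n(p)_l))_l`. -/
def sunPosMap (p : L → E) : L → E :=
  sunCoordOf ι hinj (linkLog ((plfTraj linkExp (sunJ ι) (algForce u g) ε p N).1))

variable {u ε g N}

/-- **THE PROPOSED CONFIGURATION IS THE EXPONENTIAL OF `sunPosMap`, TIMES `U`**, whenever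
`W_n(p)` is within a radius `ρ_L` of `1` at which special unitary matrices lie in the chart set:
`(Ψ_n(U, p)).1 = (suExp (sunPosMap p)_l · U_l)_l`. -/
theorem fst_sunLeapfrogProposalN_eq (hsurj : ∀ X : Matrix n n ℂ, Xᴴ = -X → X.trace = 0 → X ∈ LinearMap.range ι)
    {ρL : ℝ} (hchart : ∀ U : Matrix.specialUnitaryGroup n ℂ, ‖(U : Matrix n n ℂ) - 1‖ ≤ ρL → U ∈ suChartSet (n := n))
    {p : L → E} (hW : ‖(plfTraj linkExp (sunJ ι) (algForce u g) ε p N).1 - 1‖ ≤ ρL) :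
    (sunLeapfrogProposalN ι hι ε g N (u, p)).1 = fun l => suExp ι hι (sunPosMap ι hinj u ε g N p l) * u l := by
  set U' := (sunLeapfrogProposalN ι hι ε g N (u, p)).1 * u⁻¹ with hU'
  have hW' : coeConfig U' = (plfTraj linkExp (sunJ ι) (algForce u g) ε p N).1 := coeConfig_fst_sunLeapfrogProposalN ι hι u ε g N p
  have hmem : ∀ l, U' l ∈ suChartSet (n := n) := fun l => hchart _ (by
    calc ‖(U' l : Matrix n n ℂ) - 1‖ = ‖(coeConfig U' - 1) l‖ := by simp
      _ ≤ ‖coeConfig U' - 1‖ := norm_le_pi_norm _ l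
      _ ≤ ρL := by rw [hW']; exact hW)
  have hlog : ∀ l, suLog ι hinj (U' l) = sunPosMap ι hinj u ε g N p l := fun l => by
    simp only [sunPosMap, sunCoordOf_apply, linkLog_apply, ← hW', coeConfig_apply, suLog]
  funext l
  have hUl : (sunLeapfrogProposalN ι hι ε g N (u, p)).1 l = U' l * u l := by
    rw [hU', Pi.mul_apply, Pi.inv_apply, inv_mul_cancel_right]
  rw [hUl, ← hlog l, suExp_suLog ι hι hinj hsurj (hmem l)]

end Chart

end Summit.Ventures.LatticeQCDFlow.Exactness
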